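import Mathlib
import HarnessLib
import Summits.AtomisticToContinuum.Crystallization.Theorems.ChartedPlanarOrderRigidityDoor
import Summits.AtomisticToContinuum.Crystallization.Theorems.ChartedPlanarOrderWindowCounting

/-!
# S0 «LocalDensity»: every atom-centred ball of a clean hard-core configuration holds `≥ c₃ R³` atoms

decomp-a2c · N `stmt-AtomisticToContinuum-26636` · lens-3 g21 surplus line `EpsRegularity`, stub S0 `stub_localDensity`
(critic row 380 (2)(a) «S0 LocalDensity TRUE·S — any hand, LOW»): `WindowCounting` clause 2 freed from the root's window.
A by-name corollary of hand-1 g7's `ChartedPlanarOrderWindowCounting.ncard_atomsIn_ge` (every atom of a `δ`-separated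
everywhere-(1/16, 9/10, 1)-clean set has `≥ R³/512000` atoms within `R ≥ 1`).  The theorem's TYPE is the verbatim body of lens-3's
`LocalDensity` (HOME/decomp-a2c-lens-3/g21/bc/EpsRegularity_birth.lean), so `stub_localDensity` closes by `exact localDensity`.
DEF-FREE; axioms standard.
-/

noncomputable section

namespace Summit.AtomisticToContinuum.Crystallization.Theorems.ChartedPlanarOrderLocalDensity

open MeasureTheory Metric Set
open Literature.Probability.Process
open Summit.AtomisticToContinuum.Crystallization.Theorems.ChartedPlanarOrderRigidityDoor

/-- **S0 LocalDensity.** In a rooted `δ`-hard-core CLEAN configuration every atom-centred closed ball of radius `L ≥ 1` holds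
`≥ c₃(δ)·L³` atoms (`c₃ = 1/512000`, uniform in `δ`). [this work] -/
theorem localDensity :
    ∀ δ : ℝ, 0 < δ → ∃ c₃ : ℝ, 0 < c₃ ∧ ∀ μ : Measure E3, Literature.Probability.Process.IsRootedHardCore δ μ → IsClean μ →
      ∀ q : E3, μ {q} ≠ 0 → ∀ L : ℝ, 1 ≤ L → c₃ * L ^ 3 ≤ (Set.ncard (atomsIn μ q L) : ℝ) := by
  intro δ hδ
  refine ⟨1 / 512000, by norm_num, fun μ hμ hclean q hq L hL => ?_⟩
  obtain ⟨S, -, hsep, rfl⟩ := hμ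
  have hatoms : {p : E3 | (Measure.count : Measure E3).restrict S {p} ≠ 0} = S := by
    ext p; exact count_restrict_singleton_ne_zero_iff S p
  have hqS : q ∈ S := (count_restrict_singleton_ne_zero_iff S q).1 hq
  have hclean' : ∀ p ∈ S, Literature.Geometry.DiscreteGeometry.IsTwoShellGoodSet (1 / 16) (9 / 10) 1 S p := by
    intro p hp
    have h := hclean p ((count_restrict_singleton_ne_zero_iff S p).2 hp)
    rwa [hatoms] at h
  exact ChartedPlanarOrderWindowCounting.ncard_atomsIn_ge hδ hsep hclean' hqS hL

end Summit.AtomisticToContinuum.Crystallization.Theorems.ChartedPlanarOrderLocalDensity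

end
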